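import Mathlib.CategoryTheory.Limits.Types.Coproducts
import Mathlib.CategoryTheory.Limits.Shapes.IsTerminal
import Mathlib.CategoryTheory.Category.Preorder
import Mathlib.Logic.Equiv.Defs
import Mathlib.Data.Fintype.Defs
import Mathlib.Data.Finset.Insert
import Literature.AlgebraicGeometry.Frobenioids.Dissection
import Literature.AlgebraicGeometry.Frobenioids.CategoriesSchemaNegative
import HarnessLib

/-!
# [FrdII] §0 p. 5: the dissection PREDICATES `StronglyDissects`, `WeaklyDissects`,
# `IsWeaklyDissectible`, `IsWeaklyIndissectible` — model instances and refuted universal closures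

S. Mochizuki, *The geometry of Frobenioids II: poly-Frobenioids*, Kyushu J. Math. **62** (2008),
§0 "Categories" p. 5 [cite: MochizukiFrdII2008, §0 p.5].

PROOF-ONLY companion of `Dissection.lean` (no definitions, no instances; abc-iut cell, FACT-LIST rows
**F-1020** `StronglyDissects`, **F-1021** `WeaklyDissects`, **F-1018** `IsWeaklyDissectible`,
**F-1019** `IsWeaklyIndissectible`, all `kernel_closedness = parametrised`). The four declarations are
VOCABULARY: predicates on a family of arrows / an object of an ABSTRACT category. Nothing can be
"assumed" about them; what the kernel can record is

* that each predicate is SATISFIABLE (explicit models), and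
* that the UNIVERSAL CLOSURE of each predicate is FALSE (explicit countermodels),

so that each row reads «universal-closure REFUTED; instance forms model-witnessed» and is consumed only
through the definitions themselves. The models are the two simplest kinds of category:

**The category of types `Type u`.** An object is non-initial iff it is nonempty
(`isNonemptyObj_type_iff`, file `CategoriesSchemaNegative.lean`). A family `φᵢ : Xᵢ → A` weakly dissects `A` iff every `Xᵢ` is nonempty and
the images `φᵢ(Xᵢ)` are pairwise disjoint (`weaklyDissects_type_iff`); it strongly dissects `A` iff
every `Xᵢ` is nonempty and there is at most one index (`stronglyDissects_type_iff`) — two nonempty types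
always receive maps from the one-point type. Hence `A` is weakly dissectible iff it has two distinct
elements (`isWeaklyDissectible_type_iff`), and EVERY type is weakly indissectible
(`isWeaklyIndissectible_type`).

**Thin categories / preorders.** In a thin category weakly = strongly dissecting
(`weaklyDissects_iff_stronglyDissects_of_isThin`); in a preorder an object is non-initial iff it is
not a bottom element (`isNonemptyObj_iff_not_isBot`), and a family `xᵢ ≤ a` dissects `a` iff no `xᵢ`
is bottom and distinct members have only bottom elements as common lower bounds
(`stronglyDissects_preorder_iff`). In the lattice `Finset Bool` of subsets of a two-element set the
two singletons `{b}` strongly dissect the whole set (`stronglyDissects_finsetSingletons`), so `univ`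
is strongly (hence weakly) dissectible and NOT weakly indissectible, while a bottom element of any
preorder (here `∅`) is strongly indissectible (`isStronglyIndissectible_of_isBot`).

**Universal closures refuted** (small categories, universe `0`): `not_forall_stronglyDissects`,
`not_forall_weaklyDissects`, `not_forall_isWeaklyDissectible`, `not_forall_isWeaklyIndissectible`;
summary `dissection_predicates_schema`.

Classical category-theory bookkeeping; nothing here bears on [IUTchIII] Cor. 3.12 or takes a side;
a refuted closure is never a fact.
-/

namespace Literature.AlgebraicGeometry.Frobenioids

open CategoryTheory CategoryTheory.Limits

universe w w' v u

/-! ### Reindexing -/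

section Reindex

variable {C : Type u} [Category.{v} C] {ι : Type w} {κ : Type w'} {A : C} {X : ι → C}
  {φ : ∀ i, X i ⟶ A}

/-- A strongly dissecting family stays strongly dissecting after reindexing along an injection.
[cite: MochizukiFrdII2008, §0 p.5] -/
theorem StronglyDissects.reindex (h : StronglyDissects φ) {f : κ → ι} (hf : Function.Injective f) :
    StronglyDissects (X := fun k => X (f k)) fun k => φ (f k) :=
  ⟨fun k => h.1 (f k), fun _ _ hkl _ hB => h.2 (fun e => hkl (hf e)) hB⟩

/-- A weakly dissecting family stays weakly dissecting after reindexing along an injection.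
[cite: MochizukiFrdII2008, §0 p.5] -/
theorem WeaklyDissects.reindex (h : WeaklyDissects φ) {f : κ → ι} (hf : Function.Injective f) :
    WeaklyDissects (X := fun k => X (f k)) fun k => φ (f k) :=
  ⟨fun k => h.1 (f k), fun _ _ hkl _ hB ψk ψl => h.2 (fun e => hkl (hf e)) hB ψk ψl⟩

end Reindex

/-! ### The model `Type u` -/

section Types

-- `isNonemptyObj_type_iff : IsNonemptyObj X ↔ Nonempty X` (in `Type u`) is imported from
-- `CategoriesSchemaNegative.lean` (abc-iut-f-025).

/-- The one-point type is a non-initial object of `Type u`. [cite: MochizukiFrdII2008, §0 p.5] -/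
theorem isNonemptyObj_punit : IsNonemptyObj (PUnit.{u + 1} : Type u) :=
  (isNonemptyObj_type_iff _).2 ⟨PUnit.unit⟩

/-- In `Type u`, a family `φᵢ : Xᵢ → A` WEAKLY DISSECTS `A` iff every `Xᵢ` is nonempty and the images
of the `φᵢ` are pairwise disjoint (test object: the one-point type). [cite: MochizukiFrdII2008, §0 p.5] -/
theorem weaklyDissects_type_iff {ι : Type w} {A : Type u} {X : ι → Type u} (φ : ∀ i, X i ⟶ A) :
    WeaklyDissects φ ↔
      (∀ i, Nonempty (X i)) ∧ ∀ ⦃i j : ι⦄, i ≠ j → ∀ (xi : X i) (xj : X j), φ i xi ≠ φ j xj := by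
  constructor
  · rintro ⟨hne, hsep⟩
    refine ⟨fun i => (isNonemptyObj_type_iff _).1 (hne i), fun i j hij xi xj h => ?_⟩
    refine hsep hij isNonemptyObj_punit.{u} (homOfElement xi) (homOfElement xj) ?_
    refine ConcreteCategory.hom_ext _ _ fun c => ?_
    simpa only [types_comp_apply, homOfElement, TypeCat.ofHom_apply] using h
  · rintro ⟨hne, hsep⟩
    refine ⟨fun i => (isNonemptyObj_type_iff _).2 (hne i), fun i j hij B hB ψi ψj h => ?_⟩
    obtain ⟨b⟩ := (isNonemptyObj_type_iff B).1 hB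
    exact hsep hij (ψi b) (ψj b) (by simpa only [types_comp_apply] using types_congr_hom h b)

/-- In `Type u`, a family `φᵢ : Xᵢ → A` STRONGLY DISSECTS `A` iff every `Xᵢ` is nonempty and the index
type has at most one element: two nonempty types always receive maps from the one-point type, so two
distinct indices are impossible. [cite: MochizukiFrdII2008, §0 p.5] -/
theorem stronglyDissects_type_iff {ι : Type w} {A : Type u} {X : ι → Type u} (φ : ∀ i, X i ⟶ A) :
    StronglyDissects φ ↔ (∀ i, Nonempty (X i)) ∧ ∀ i j : ι, i = j := by
  constructor
  · rintro ⟨hne, hsep⟩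
    refine ⟨fun i => (isNonemptyObj_type_iff _).1 (hne i), fun i j => ?_⟩
    by_contra hij
    obtain ⟨xi⟩ := (isNonemptyObj_type_iff _).1 (hne i)
    obtain ⟨xj⟩ := (isNonemptyObj_type_iff _).1 (hne j)
    exact hsep hij isNonemptyObj_punit.{u} ⟨⟨homOfElement xi⟩, ⟨homOfElement xj⟩⟩
  · rintro ⟨hne, hsub⟩
    exact ⟨fun i => (isNonemptyObj_type_iff _).2 (hne i), fun i j hij => absurd (hsub i j) hij⟩

/-- In `Type u`, NO object is strongly dissectible: `Fin 2` has two distinct indices.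
[cite: MochizukiFrdII2008, §0 p.5] -/
theorem not_isStronglyDissectible_type (A : Type u) : ¬ IsStronglyDissectible A := by
  rintro ⟨X, φ, hφ⟩
  exact absurd (((stronglyDissects_type_iff φ).1 hφ).2 0 1) (by decide)

/-- **F-1019, model instance.** In `Type u` EVERY object is weakly indissectible.
[cite: MochizukiFrdII2008, §0 p.5] -/
theorem isWeaklyIndissectible_type (A : Type u) : IsWeaklyIndissectible A :=
  not_isStronglyDissectible_type A

/-- **F-1018, model instance (exact form).** In `Type u` an object `A` is weakly dissectible iff it has
two distinct elements: the two constant maps from the one-point type at `a ≠ b` weakly dissect `A`, and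
conversely the images of a weakly dissecting pair contain two distinct points.
[cite: MochizukiFrdII2008, §0 p.5] -/
theorem isWeaklyDissectible_type_iff (A : Type u) : IsWeaklyDissectible A ↔ Nontrivial A := by
  constructor
  · rintro ⟨X, φ, hφ⟩
    obtain ⟨hne, hsep⟩ := (weaklyDissects_type_iff φ).1 hφ
    obtain ⟨x0⟩ := hne 0
    obtain ⟨x1⟩ := hne 1
    exact ⟨⟨φ 0 x0, φ 1 x1, hsep (by decide) x0 x1⟩⟩
  · rintro ⟨⟨a, b, hab⟩⟩
    -- the pair of constant maps `* ↦ a`, `* ↦ b`, indexed by `Bool`, then by `Fin 2 ≃ Bool`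
    have hW : WeaklyDissects (C := Type u) (X := fun _ : Bool => PUnit.{u + 1}) (A := A)
        fun c => homOfElement (bif c then a else b) := by
      refine (weaklyDissects_type_iff _).2 ⟨fun _ => ⟨PUnit.unit⟩, fun c c' hcc' xi xj h => hcc' ?_⟩
      have h' : (bif c then a else b) = (bif c' then a else b) := by
        simpa only [homOfElement, TypeCat.ofHom_apply] using h
      cases c <;> cases c'
      · rfl
      · exact absurd h'.symm hab
      · exact absurd h' hab
      · rfl
    exact ⟨_, _, hW.reindex finTwoEquiv.injective⟩

/-- In `Type`, `Bool` is weakly dissectible. [cite: MochizukiFrdII2008, §0 p.5] -/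
theorem isWeaklyDissectible_bool : IsWeaklyDissectible (Bool : Type) :=
  (isWeaklyDissectible_type_iff _).2 inferInstance

/-- In `Type u`, the one-point type is NOT weakly dissectible, i.e. it is strongly indissectible.
[cite: MochizukiFrdII2008, §0 p.5] -/
theorem isStronglyIndissectible_punit : IsStronglyIndissectible (PUnit.{u + 1} : Type u) := fun h =>
  not_nontrivial _ ((isWeaklyDissectible_type_iff _).1 h)

/-- **F-1021, model instance.** In `Type` the two points of `Bool` weakly dissect `Bool`.
[cite: MochizukiFrdII2008, §0 p.5] -/
theorem weaklyDissects_boolPoints :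
    WeaklyDissects (C := Type) (X := fun _ : Bool => PUnit) (A := Bool) fun b => homOfElement b :=
  (weaklyDissects_type_iff _).2
    ⟨fun _ => ⟨PUnit.unit⟩, fun _ _ hij _ _ h =>
      hij (by simpa only [homOfElement, TypeCat.ofHom_apply] using h)⟩

/-- **F-1020, model instance (degenerate index).** In `Type` a ONE-member family with nonempty domain
strongly dissects. [cite: MochizukiFrdII2008, §0 p.5] -/
theorem stronglyDissects_unitFamily :
    StronglyDissects (C := Type) (X := fun _ : Unit => Bool) (A := Bool) fun _ => 𝟙 Bool :=
  (stronglyDissects_type_iff _).2 ⟨fun _ => ⟨true⟩, fun _ _ => Subsingleton.elim _ _⟩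

end Types

/-! ### Thin categories and preorders -/

section Thin

variable {C : Type u} [Category.{v} C]

/-- In a THIN category (all parallel arrows equal) a family weakly dissects iff it strongly dissects:
the composites `ψᵢ ≫ φᵢ`, `ψⱼ ≫ φⱼ : B → A` are automatically equal. [cite: MochizukiFrdII2008, §0 p.5] -/
theorem weaklyDissects_iff_stronglyDissects_of_isThin [Quiver.IsThin C] {ι : Type w} {A : C}
    {X : ι → C} (φ : ∀ i, X i ⟶ A) : WeaklyDissects φ ↔ StronglyDissects φ := by
  refine ⟨fun h => ⟨h.1, fun i j hij B hB hBoth => ?_⟩, StronglyDissects.weaklyDissects⟩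
  obtain ⟨⟨ψi⟩, ⟨ψj⟩⟩ := hBoth
  exact h.2 hij hB ψi ψj (Subsingleton.elim _ _)

/-- In a thin category, weakly dissectible = strongly dissectible. [cite: MochizukiFrdII2008, §0 p.5] -/
theorem isWeaklyDissectible_iff_isStronglyDissectible_of_isThin [Quiver.IsThin C] (A : C) :
    IsWeaklyDissectible A ↔ IsStronglyDissectible A :=
  exists_congr fun _ => exists_congr fun φ => weaklyDissects_iff_stronglyDissects_of_isThin φ

/-- In a thin category, weakly indissectible = strongly indissectible.
[cite: MochizukiFrdII2008, §0 p.5] -/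
theorem isWeaklyIndissectible_iff_isStronglyIndissectible_of_isThin [Quiver.IsThin C] (A : C) :
    IsWeaklyIndissectible A ↔ IsStronglyIndissectible A :=
  not_congr (isWeaklyDissectible_iff_isStronglyDissectible_of_isThin A).symm

end Thin

section Preorder

variable {P : Type u} [Preorder P]

/-- In (the category of) a preorder an object is non-initial iff it is not a bottom element.
[cite: MochizukiFrdII2008, §0 p.5] -/
theorem isNonemptyObj_iff_not_isBot (x : P) : IsNonemptyObj x ↔ ¬ IsBot x := by
  unfold IsNonemptyObj
  rw [← not_nonempty_iff]
  refine not_congr ⟨fun ⟨t⟩ y => leOfHom (t.to y), fun h => ⟨?_⟩⟩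
  exact IsInitial.ofUniqueHom (fun y => homOfLE (h y)) fun _ _ => Subsingleton.elim _ _

/-- In a preorder, a family `xᵢ ≤ a` strongly (equivalently — preorders are thin — weakly) dissects
`a` iff no `xᵢ` is a bottom element and two members with distinct indices have no common lower bound
other than bottom elements. [cite: MochizukiFrdII2008, §0 p.5] -/
theorem stronglyDissects_preorder_iff {ι : Type w} {a : P} {x : ι → P} (φ : ∀ i, x i ⟶ a) :
    StronglyDissects φ ↔
      (∀ i, ¬ IsBot (x i)) ∧ ∀ ⦃i j : ι⦄, i ≠ j → ∀ b, ¬ IsBot b → ¬ (b ≤ x i ∧ b ≤ x j) := by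
  simp only [StronglyDissects, isNonemptyObj_iff_not_isBot]
  refine and_congr Iff.rfl (forall₂_congr fun i j => forall_congr' fun _ => ?_)
  refine ⟨fun h b hb hle => h hb ⟨⟨homOfLE hle.1⟩, ⟨homOfLE hle.2⟩⟩, fun h b hb hboth => ?_⟩
  obtain ⟨⟨fi⟩, ⟨fj⟩⟩ := hboth
  exact h b hb ⟨leOfHom fi, leOfHom fj⟩

/-- In a preorder a BOTTOM element is strongly indissectible: the members of a dissecting family
below it would be bottom elements too, i.e. initial. [cite: MochizukiFrdII2008, §0 p.5] -/
theorem isStronglyIndissectible_of_isBot {a : P} (ha : IsBot a) : IsStronglyIndissectible a := by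
  rintro ⟨x, φ, hne, -⟩
  exact (isNonemptyObj_iff_not_isBot _).1 (hne 0) fun y => (leOfHom (φ 0)).trans (ha y)

/-- In the lattice `Finset Bool` (subsets of a two-element set) the singletons lie under `univ`.
[cite: MochizukiFrdII2008, §0 p.5] -/
theorem singleton_le_univ (b : Bool) : ({b} : Finset Bool) ≤ Finset.univ :=
  Finset.subset_univ _

/-- **F-1020, model instance.** In the lattice `Finset Bool` the singletons `{false}`, `{true}`
STRONGLY DISSECT the whole set `univ`: a singleton is not a bottom element, and a common lower bound
of two distinct singletons is `∅`, the bottom (initial) element. [cite: MochizukiFrdII2008, §0 p.5] -/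
theorem stronglyDissects_finsetSingletons :
    StronglyDissects (C := Finset Bool) (A := Finset.univ) (X := fun b : Bool => ({b} : Finset Bool))
      fun b => homOfLE (singleton_le_univ b) := by
  refine (stronglyDissects_preorder_iff _).2 ⟨fun b hb => ?_, fun b b' hbb' c hc hle => hc fun y => ?_⟩
  · have h : b = !b := Finset.singleton_subset_singleton.1 (hb {!b})
    revert h
    cases b <;> decide
  · have h1 : c ⊆ {b} := hle.1
    have h2 : c ⊆ {b'} := hle.2
    rcases Finset.subset_singleton_iff.1 h1 with rfl | rfl
    · exact Finset.empty_subset _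
    · exact absurd (Finset.singleton_subset_singleton.1 h2) hbb'

/-- Hence `univ : Finset Bool` is strongly dissectible … [cite: MochizukiFrdII2008, §0 p.5] -/
theorem isStronglyDissectible_finsetUniv : IsStronglyDissectible (Finset.univ : Finset Bool) :=
  ⟨_, _, stronglyDissects_finsetSingletons.reindex finTwoEquiv.injective⟩

/-- **F-1021, model instance.** … the same singletons WEAKLY dissect it …
[cite: MochizukiFrdII2008, §0 p.5] -/
theorem weaklyDissects_finsetSingletons :
    WeaklyDissects (C := Finset Bool) (A := Finset.univ) (X := fun b : Bool => ({b} : Finset Bool))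
      fun b => homOfLE (singleton_le_univ b) :=
  stronglyDissects_finsetSingletons.weaklyDissects

/-- **F-1018, model instance.** … so `univ : Finset Bool` is weakly dissectible …
[cite: MochizukiFrdII2008, §0 p.5] -/
theorem isWeaklyDissectible_finsetUniv : IsWeaklyDissectible (Finset.univ : Finset Bool) :=
  isStronglyDissectible_finsetUniv.isWeaklyDissectible

/-- … and NOT weakly indissectible. [cite: MochizukiFrdII2008, §0 p.5] -/
theorem not_isWeaklyIndissectible_finsetUniv :
    ¬ IsWeaklyIndissectible (Finset.univ : Finset Bool) :=
  fun h => h isStronglyDissectible_finsetUniv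

/-- … while `∅ : Finset Bool` is strongly, hence weakly, indissectible (**F-1019, model instance** in
a category that also has dissectible objects). [cite: MochizukiFrdII2008, §0 p.5] -/
theorem isWeaklyIndissectible_finsetEmpty : IsWeaklyIndissectible (∅ : Finset Bool) :=
  (isStronglyIndissectible_of_isBot fun y => Finset.empty_subset y)
    |>.isWeaklyIndissectible

end Preorder

/-! ### The universal closures are false -/

section Closures

/-- **FACT-LIST F-1020 `StronglyDissects`: universal closure REFUTED.** Witness: in the poset `Unit`
the identity family on `()` does not strongly dissect (its domain is a bottom element, i.e. initial).
[cite: MochizukiFrdII2008, §0 p.5] -/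
theorem not_forall_stronglyDissects :
    ¬ ∀ (C : Type) [SmallCategory C] (ι : Type) (A : C) (X : ι → C) (φ : ∀ i, X i ⟶ A),
        StronglyDissects φ := fun h =>
  (isNonemptyObj_iff_not_isBot _).1 ((h Unit Unit () (fun _ => ()) fun _ => 𝟙 _).1 ()) fun _ => le_rfl

/-- **FACT-LIST F-1021 `WeaklyDissects`: universal closure REFUTED** (same witness).
[cite: MochizukiFrdII2008, §0 p.5] -/
theorem not_forall_weaklyDissects :
    ¬ ∀ (C : Type) [SmallCategory C] (ι : Type) (A : C) (X : ι → C) (φ : ∀ i, X i ⟶ A),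
        WeaklyDissects φ := fun h =>
  (isNonemptyObj_iff_not_isBot _).1 ((h Unit Unit () (fun _ => ()) fun _ => 𝟙 _).1 ()) fun _ => le_rfl

/-- **FACT-LIST F-1018 `IsWeaklyDissectible`: universal closure REFUTED.** Witness: the unique object of
the poset `Unit` is a bottom element, hence strongly indissectible. [cite: MochizukiFrdII2008, §0 p.5] -/
theorem not_forall_isWeaklyDissectible :
    ¬ ∀ (C : Type) [SmallCategory C] (A : C), IsWeaklyDissectible A := fun h =>
  isStronglyIndissectible_of_isBot (P := Unit) (a := ()) (fun _ => le_rfl) (h Unit ())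

/-- **FACT-LIST F-1019 `IsWeaklyIndissectible`: universal closure REFUTED.** Witness: the top of the
lattice `Finset Bool` is strongly dissectible. [cite: MochizukiFrdII2008, §0 p.5] -/
theorem not_forall_isWeaklyIndissectible :
    ¬ ∀ (C : Type) [SmallCategory C] (A : C), IsWeaklyIndissectible A := fun h =>
  not_isWeaklyIndissectible_finsetUniv (h (Finset Bool) Finset.univ)

/-- Summary for the four rows F-1020 / F-1021 / F-1018 / F-1019: each predicate is SATISFIABLE and has
a REFUTED universal closure, so it is admissible only through its definition, never as a blanket
hypothesis. [cite: MochizukiFrdII2008, §0 p.5] -/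
theorem dissection_predicates_schema :
    ((∃ (C : Type) (_ : SmallCategory C) (ι : Type) (A : C) (X : ι → C) (φ : ∀ i, X i ⟶ A),
        StronglyDissects φ) ∧
      ¬ ∀ (C : Type) [SmallCategory C] (ι : Type) (A : C) (X : ι → C) (φ : ∀ i, X i ⟶ A),
        StronglyDissects φ) ∧
    ((∃ (C : Type) (_ : SmallCategory C) (ι : Type) (A : C) (X : ι → C) (φ : ∀ i, X i ⟶ A),
        WeaklyDissects φ) ∧
      ¬ ∀ (C : Type) [SmallCategory C] (ι : Type) (A : C) (X : ι → C) (φ : ∀ i, X i ⟶ A),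
        WeaklyDissects φ) ∧
    ((∃ (C : Type) (_ : SmallCategory C) (A : C), IsWeaklyDissectible A) ∧
      ¬ ∀ (C : Type) [SmallCategory C] (A : C), IsWeaklyDissectible A) ∧
    ((∃ (C : Type) (_ : SmallCategory C) (A : C), IsWeaklyIndissectible A) ∧
      ¬ ∀ (C : Type) [SmallCategory C] (A : C), IsWeaklyIndissectible A) :=
  ⟨⟨⟨_, inferInstance, _, _, _, _, stronglyDissects_finsetSingletons⟩, not_forall_stronglyDissects⟩,
    ⟨⟨_, inferInstance, _, _, _, _, weaklyDissects_finsetSingletons⟩, not_forall_weaklyDissects⟩,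
    ⟨⟨_, inferInstance, _, isWeaklyDissectible_finsetUniv⟩, not_forall_isWeaklyDissectible⟩,
    ⟨⟨_, inferInstance, _, isWeaklyIndissectible_finsetEmpty⟩, not_forall_isWeaklyIndissectible⟩⟩

end Closures

end Literature.AlgebraicGeometry.Frobenioids
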